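import Summits.QuantumFields.YangMills.Theorems.BalabanUVNodesN15TwoSpacingGluingNeumannKnitEntryZero
import Summits.QuantumFields.YangMills.Theorems.BalabanUVNodesN15TwoSpacingGluingNeumannKnitEntryOneDefect
import Summits.QuantumFields.YangMills.Theorems.BalabanUVNodesN15TwoSpacingGluingNeumannKnitEntryTwoDefect
import Summits.QuantumFields.YangMills.Theorems.BalabanUVNodesN15TwoSpacingGluingNeumannKnitEntryThreeTwoGrid
import Summits.QuantumFields.YangMills.Theorems.BalabanUVNodesN15TwoSpacingGluingNode
import HarnessLib

/-!
# THE GLUING STEP AT TWO LATTICE SPACINGS, L: FILE 50's FOURTEEN-ROW LETTER BUNDLE `GluedLetters` FOR THE COVER's GLUED PAIR ON THE DOUBLED TORUS, UNIFORM CONSTANTS, SIZE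
# PARAMETER `M = L^m`, MODULO THE THREE ADJOINT-REMAINDER ROWS (dag-n15-c g13, FILE 92; N15 = NE2, s1 «background-layer OPERATOR ingredient»)

Cell `pub-ymgap`, seat `pub-ymgap-dag-n15-c` (R134 (a); HUMAN RULING D-0062), generation 13.  `bears_on: R4∕N15 · K3⁸ SpineGivenEndpointR13SepCoPHV (stmt-QuantumFields-27366)`
(KEY MAP v2).  Filed `--supports stmt-QuantumFields-27366 --as helper` — COUNT-NEUTRAL.  Theorems only (0 `def`, 0 `sorry`).  Imports BY NAME FILES 85, 88, 90, 91 (through them 84, 86,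
87, 89, 80, the chain 45–79 and dag-n15-a's PROGRAMME N) and FILE 50 (`GluedLetters`); nothing in the tree is modified.

WHAT.  §1 ★★ `knitMaj_weaken`, `knitMaj_weaken₁` (constant ∕ rate-factor ∕ decay weakening of a majorant).  §2 ★★★ **`gluedLetters_knit_of_rightRows`** — `d ≥ 1`, odd `L ≥ 3`, `a > 0`:
GIVEN the three adjoint-remainder rows of the cover (`R̃ = remainderL Δ_a h G ≤ (κ_L∕L^m)e^{−δ_Ld}` at both spacings, `𝔇(R̃′, R̃) ≤ r_L(L^k)^{−γ_L}e^{−δ_Ld}`, in a window `M₅ ≤ L^m`)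
there are UNIFORM `δ, γ > 0`, `A, κ₀, m₀, r₀ ≥ 0` such that at every `(m, k ≥ 1, r, μ, ν)` with `4 ≤ L^k`, `M₅ ≤ L^m` FILE 50's bundle
`GluedLetters blkFine kingPrV G₀ R R̃ ∇_μ Δ ∇*_ν G₀′ R′ R̃′ ∇′_μ Δ′ ∇′*_ν A (κ₀∕L^m) (m₀(L^k)^{−γ}) (r₀(L^k)^{−γ}) δ` holds over dag-n15-a's SIZED carrier `unitTorusGeoS L k (2L·L^m) (L^m)`
(the [B9] size parameter IS `L^m`) — `G₀ = parametrix h G`, `R = remainder Δ_a h G`, `R̃ = remainderL Δ_a h G` of FILE 70's cover (`knitH`, `knitG`), `∇_μ = fgrad`, `∇*_ν = fgradAdj`,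
`Δ = lapOp … 0`; rows 1, 5, 6, 9, 13 = FILE 91 `knit_entryZero_rows`; 2, 10 = FILES 84∕85; 3, 11 = FILES 89∕90 (`d ≥ 1`, rate `(L^k)^{−1∕(8(d+1))}`); 4, 12 = FILES 86∕88; 7, 8, 14 = the
hypothesis; one decay rate by `min`, one constant per slot by `max`, the rate factors `(L^k)^{−1∕16}`, `(L^k)^{−1∕(8(d+1))}`, `(L^k)^{−γ_L}` dominated by `(L^k)^{−γ}`, `γ = min(1∕(8(d+1)), γ_L)`,
fine blocks through King's pairing (`blkFine_comp_kingPrV`).  CONSUMER: the next file calls FILE 50's socket `ne2PlusOperator_glued_of_letters` with it.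

HONEST FRAMING ∕ LIMITS.  CONDITIONAL on the displayed adjoint-remainder rows (dag-n15-a N-IIn right rows `T±`; its `(c)⁺` is itself conditional on the located source-Hölder
letter `hSrc`) — HYPOTHESES here, not proved.  Glued `U ≡ 1` family; block-majorant bookkeeping over LANDED rows on the doubled-cube torus MODEL (cube = half torus: circular as an
estimate); nothing of [B6] (2.38)–(2.40) ∕ [B9] Thm 3.1, 3.14 asserted.  NE2⁺ NOT PRINTED, NOT proved; N15 NOT discharged; counts of record UNMOVED (typed 28∕28 · discharged 5∕27); one
finite 𝕋⁴ at fixed ε per index — NOT infinite volume, NOT OS on ℝ⁴, NOT a mass gap, NOT Clay; R4 closes `BalabanLadder.UV` only.  Restate-immune (no Theses import).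
-/

noncomputable section

namespace Summit.QuantumFields.YangMills.BalabanUVNodes.N15.Gluing

open Real
open Literature.MathematicalPhysics.QuantumFieldTheory.Balaban1983to89
open Literature.MathematicalPhysics.QuantumFieldTheory.Balaban1983to89.B5Prop11Plancherel (Tor fine)
open Literature.MathematicalPhysics.QuantumFieldTheory.Balaban1983to89.B11SectG (BlockNorm HasMaj RowSum)
open Literature.MathematicalPhysics.QuantumFieldTheory.Balaban1983to89.T4EtaRateDefect (idef)
open Literature.MathematicalPhysics.QuantumFieldTheory.Balaban1983to89.T4EtaRateCoeffDefect (pull)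
open Literature.MathematicalPhysics.QuantumFieldTheory.Balaban1983to89.B6UnitTorusCarrier (unitTorusGeo)
open Literature.MathematicalPhysics.QuantumFieldTheory.Balaban1983to89.B5SiteBridgeP12 (MP)
open Literature.MathematicalPhysics.QuantumFieldTheory.King1986.Torus (blockOf tdistT tdistT_nonneg)
open Summit.QuantumFields.YangMills.BalabanUVNodes.N15.VectorPiece (bshiftEquiv kingPrV blkFine blkFine_comp_kingPrV unitTorusGeoS)
open Summit.QuantumFields.YangMills.BalabanUVNodes.N15.BackgroundLayer (fgrad fgradAdj)
open Summit.QuantumFields.YangMills.BalabanUVNodes.N15.TwoGrid (paramsOf deltaOp)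

/-! ## §1 Weakening a majorant's constant, rate factor and decay rate -/

section Weaken

/-- `c·ρ·e^{−δ′t} ≤ C·θ·e^{−δt}` for `c ≤ C`, `0 ≤ ρ ≤ θ`, `δ ≤ δ′`, `t ≥ 0`, `C ≥ 0`. [folklore] -/
theorem knitMaj_weaken {t c C ρ θ δ δ' : ℝ} (ht : 0 ≤ t) (hc : c ≤ C) (hC : 0 ≤ C) (hρ : ρ ≤ θ) (hρ0 : 0 ≤ ρ) (hδ : δ ≤ δ') :
    c * ρ * Real.exp (-(δ' * t)) ≤ C * θ * Real.exp (-(δ * t)) :=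
  mul_le_mul (mul_le_mul hc hρ hρ0 hC) (Real.exp_le_exp.mpr (neg_le_neg (mul_le_mul_of_nonneg_right hδ ht))) (Real.exp_nonneg _)
    (mul_nonneg hC (hρ0.trans hρ))

/-- `c·e^{−δ′t} ≤ C·e^{−δt}` for `c ≤ C`, `δ ≤ δ′`, `t ≥ 0`, `C ≥ 0`. [folklore] -/
theorem knitMaj_weaken₁ {t c C δ δ' : ℝ} (ht : 0 ≤ t) (hc : c ≤ C) (hC : 0 ≤ C) (hδ : δ ≤ δ') :
    c * Real.exp (-(δ' * t)) ≤ C * Real.exp (-(δ * t)) :=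
  mul_le_mul hc (Real.exp_le_exp.mpr (neg_le_neg (mul_le_mul_of_nonneg_right hδ ht))) (Real.exp_nonneg _) hC

end Weaken

/-! ## §2 The letter bundle, modulo the adjoint-remainder rows -/

section Bundle

variable {d : ℕ} {L : ℕ} [NeZero L]

/-- ★★★ **FILE 50's FOURTEEN-ROW LETTER BUNDLE FOR THE COVER's GLUED PAIR, UNIFORM CONSTANTS, MODULO THE THREE ADJOINT-REMAINDER ROWS.**  `d ≥ 1`, odd `L ≥ 3`, `a > 0`.  IF the adjoint
remainder `R̃ = remainderL Δ_a h G` of the cover obeys `R̃ ≤ (κ_L∕L^m)e^{−δ_Ld}` at both spacings and `𝔇(R̃′, R̃) ≤ r_L(L^k)^{−γ_L}e^{−δ_Ld}` whenever `k ≥ 1`, `4 ≤ L^k`, `M₅ ≤ L^m`, THEN there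
are `δ, γ > 0`, `A, κ₀, m₀, r₀ ≥ 0` with `GluedLetters blkFine kingPrV G₀ R R̃ ∇_μ Δ ∇*_ν G₀′ R′ R̃′ ∇′_μ Δ′ ∇′*_ν A (κ₀∕L^m) (m₀(L^k)^{−γ}) (r₀(L^k)^{−γ}) δ` over the SIZED carrier `unitTorusGeoS L k · (L^m)` at every
`(m, k, r, μ, ν)` with `M₅ ≤ L^m` — rows 1, 5, 6, 9, 13 FILE 91; 2, 10 FILES 84∕85; 3, 11 FILES 89∕90; 4, 12 FILES 86∕88; 7, 8, 14 the hypothesis.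
[cite: Balaban1984PropagatorsII, (2.133)–(2.136) p.247 (shapes, mechanism); Balaban1985BackgroundPropagators, Thm 3.14 pp.426–427 (difference template); King1986, Prop. 3.9 (3.73) p.665
(rate factor)] -/
theorem gluedLetters_knit_of_rightRows (hd1 : 1 ≤ d) (hL : Odd L ∧ 1 < L) {a : ℝ} (ha : 0 < a) {M₅ : ℝ}
    (hRL : ∃ δL κL rL γL : ℝ, 0 < δL ∧ 0 ≤ κL ∧ 0 ≤ rL ∧ 0 < γL ∧ ∀ (m kk r : ℕ) (_hk : 1 ≤ kk) (_hn4 : 4 ≤ L ^ kk) (_hM : M₅ ≤ (L : ℝ) ^ m),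
      HasMaj (BlockNorm.ofBlocks (unitTorusGeo L kk (MP (paramsOf d L (m + 1) kk hL)))
          (fun b : Tor (fine (L ^ kk) (MP (paramsOf d L (m + 1) kk hL))) × Fin (d + 1) => blockOf (L ^ kk) (MP (paramsOf d L (m + 1) kk hL)) b.1))
        (BlockNorm.ofBlocks (unitTorusGeo L kk (MP (paramsOf d L (m + 1) kk hL)))
          (fun b : Tor (fine (L ^ kk) (MP (paramsOf d L (m + 1) kk hL))) × Fin (d + 1) => blockOf (L ^ kk) (MP (paramsOf d L (m + 1) kk hL)) b.1))
        (remainderL (deltaOp (MP (paramsOf d L (m + 1) kk hL)) (L ^ kk) a) (knitH d L m kk (L ^ kk) hL) (knitG d L m kk (L ^ kk) hL a))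
        (fun y y' => κL / (L : ℝ) ^ m * Real.exp (-(δL * tdistT (MP (paramsOf d L (m + 1) kk hL)) y y'))) ∧
      HasMaj (BlockNorm.ofBlocks (unitTorusGeo L kk (MP (paramsOf d L (m + 1) kk hL)))
          (fun x : Tor (fine (L ^ r * L ^ kk) (MP (paramsOf d L (m + 1) kk hL))) × Fin (d + 1) => blockOf (L ^ r * L ^ kk) (MP (paramsOf d L (m + 1) kk hL)) x.1))
        (BlockNorm.ofBlocks (unitTorusGeo L kk (MP (paramsOf d L (m + 1) kk hL)))
          (fun x : Tor (fine (L ^ r * L ^ kk) (MP (paramsOf d L (m + 1) kk hL))) × Fin (d + 1) => blockOf (L ^ r * L ^ kk) (MP (paramsOf d L (m + 1) kk hL)) x.1))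
        (remainderL (deltaOp (MP (paramsOf d L (m + 1) kk hL)) (L ^ r * L ^ kk) a) (knitH d L m kk (L ^ r * L ^ kk) hL) (knitG d L m kk (L ^ r * L ^ kk) hL a))
        (fun y y' => κL / (L : ℝ) ^ m * Real.exp (-(δL * tdistT (MP (paramsOf d L (m + 1) kk hL)) y y'))) ∧
      HasMaj (BlockNorm.ofBlocks (unitTorusGeo L kk (MP (paramsOf d L (m + 1) kk hL)))
          (fun b : Tor (fine (L ^ kk) (MP (paramsOf d L (m + 1) kk hL))) × Fin (d + 1) => blockOf (L ^ kk) (MP (paramsOf d L (m + 1) kk hL)) b.1))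
        (BlockNorm.ofBlocks (unitTorusGeo L kk (MP (paramsOf d L (m + 1) kk hL)))
          (fun x : Tor (fine (L ^ r * L ^ kk) (MP (paramsOf d L (m + 1) kk hL))) × Fin (d + 1) => blockOf (L ^ r * L ^ kk) (MP (paramsOf d L (m + 1) kk hL)) x.1))
        (idef (pull (kingPrV L kk r (MP (paramsOf d L (m + 1) kk hL)))) (pull (kingPrV L kk r (MP (paramsOf d L (m + 1) kk hL))))
          (remainderL (deltaOp (MP (paramsOf d L (m + 1) kk hL)) (L ^ r * L ^ kk) a) (knitH d L m kk (L ^ r * L ^ kk) hL) (knitG d L m kk (L ^ r * L ^ kk) hL a))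
          (remainderL (deltaOp (MP (paramsOf d L (m + 1) kk hL)) (L ^ kk) a) (knitH d L m kk (L ^ kk) hL) (knitG d L m kk (L ^ kk) hL a)))
        (fun y y' => rL * ((L : ℝ) ^ kk) ^ (-γL) * Real.exp (-(δL * tdistT (MP (paramsOf d L (m + 1) kk hL)) y y')))) :
    ∃ δ A κ₀ m₀ r₀ γ : ℝ, 0 < δ ∧ 0 ≤ A ∧ 0 ≤ κ₀ ∧ 0 ≤ m₀ ∧ 0 ≤ r₀ ∧ 0 < γ ∧ ∀ (m kk r : ℕ) (_hk : 1 ≤ kk) (_hn4 : 4 ≤ L ^ kk) (μ ν : Fin (d + 1)) (_hM : M₅ ≤ (L : ℝ) ^ m),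
      GluedLetters (g := unitTorusGeoS L kk (MP (paramsOf d L (m + 1) kk hL)) ((L : ℝ) ^ m)) (blkFine L kk (MP (paramsOf d L (m + 1) kk hL)))
        (kingPrV L kk r (MP (paramsOf d L (m + 1) kk hL)))
        (parametrix (knitH d L m kk (L ^ kk) hL) (knitG d L m kk (L ^ kk) hL a))
        (remainder (deltaOp (MP (paramsOf d L (m + 1) kk hL)) (L ^ kk) a) (knitH d L m kk (L ^ kk) hL) (knitG d L m kk (L ^ kk) hL a))
        (remainderL (deltaOp (MP (paramsOf d L (m + 1) kk hL)) (L ^ kk) a) (knitH d L m kk (L ^ kk) hL) (knitG d L m kk (L ^ kk) hL a))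
        (fgrad ((L ^ kk : ℕ) : ℝ) (bshiftEquiv (MP (paramsOf d L (m + 1) kk hL)) (L ^ kk) μ))
        (lapOp ((L ^ kk : ℕ) : ℝ) (bshiftEquiv (MP (paramsOf d L (m + 1) kk hL)) (L ^ kk)) 0)
        (fgradAdj ((L ^ kk : ℕ) : ℝ) (bshiftEquiv (MP (paramsOf d L (m + 1) kk hL)) (L ^ kk) ν))
        (parametrix (knitH d L m kk (L ^ r * L ^ kk) hL) (knitG d L m kk (L ^ r * L ^ kk) hL a))
        (remainder (deltaOp (MP (paramsOf d L (m + 1) kk hL)) (L ^ r * L ^ kk) a) (knitH d L m kk (L ^ r * L ^ kk) hL) (knitG d L m kk (L ^ r * L ^ kk) hL a))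
        (remainderL (deltaOp (MP (paramsOf d L (m + 1) kk hL)) (L ^ r * L ^ kk) a) (knitH d L m kk (L ^ r * L ^ kk) hL) (knitG d L m kk (L ^ r * L ^ kk) hL a))
        (fgrad ((L ^ r * L ^ kk : ℕ) : ℝ) (bshiftEquiv (MP (paramsOf d L (m + 1) kk hL)) (L ^ r * L ^ kk) μ))
        (lapOp ((L ^ r * L ^ kk : ℕ) : ℝ) (bshiftEquiv (MP (paramsOf d L (m + 1) kk hL)) (L ^ r * L ^ kk)) 0)
        (fgradAdj ((L ^ r * L ^ kk : ℕ) : ℝ) (bshiftEquiv (MP (paramsOf d L (m + 1) kk hL)) (L ^ r * L ^ kk) ν))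
        A (κ₀ / (L : ℝ) ^ m) (m₀ * ((L : ℝ) ^ kk) ^ (-γ)) (r₀ * ((L : ℝ) ^ kk) ^ (-γ)) δ := by
  have hL1 : 1 ≤ L := by have := hL.2; omega
  -- the landed rows (FILES 91, 84, 85, 89, 90, 86, 88) and the hypothesis
  obtain ⟨δ0, A0, κ0, m0, r0, hδ0, hA0, hκ0, hm0, hr0, H0⟩ := knit_entryZero_rows (d := d) hL ha
  obtain ⟨δ1, A1, hδ1, hA1, H1⟩ := hasMaj_grad_parametrix_knit (d := d) hL ha
  obtain ⟨e1, D1, he1, hD1, H1d⟩ := hasMaj_idef_grad_parametrix_knit (d := d) hL ha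
  obtain ⟨δ2, A2, hδ2, hA2, H2⟩ := hasMaj_parametrix_divAdj_knit (d := d) hL ha
  obtain ⟨e2, D2, he2, hD2, H2d⟩ := hasMaj_idef_parametrix_divAdj_knit (d := d) hd1 hL ha
  obtain ⟨δ3, A3, hδ3, hA3, H3⟩ := hasMaj_lap_parametrix_knit (d := d) hL ha
  obtain ⟨e3, D3, he3, hD3, H3d⟩ := hasMaj_idef_lap_parametrix_knit (d := d) hL ha
  obtain ⟨δL, κL, rL, γL, hδL, hκL, hrL, hγL, HL⟩ := hRL
  -- one rate, one constant per slot
  set δ : ℝ := min (min (min δ0 δ1) (min e1 δ2)) (min (min e2 δ3) (min e3 δL)) with hδ_def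
  have hδ : 0 < δ := lt_min (lt_min (lt_min hδ0 hδ1) (lt_min he1 hδ2)) (lt_min (lt_min he2 hδ3) (lt_min he3 hδL))
  have dδ0 : δ ≤ δ0 := (min_le_left _ _).trans ((min_le_left _ _).trans (min_le_left _ _))
  have dδ1 : δ ≤ δ1 := (min_le_left _ _).trans ((min_le_left _ _).trans (min_le_right _ _))
  have de1 : δ ≤ e1 := (min_le_left _ _).trans ((min_le_right _ _).trans (min_le_left _ _))
  have dδ2 : δ ≤ δ2 := (min_le_left _ _).trans ((min_le_right _ _).trans (min_le_right _ _))
  have de2 : δ ≤ e2 := (min_le_right _ _).trans ((min_le_left _ _).trans (min_le_left _ _))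
  have dδ3 : δ ≤ δ3 := (min_le_right _ _).trans ((min_le_left _ _).trans (min_le_right _ _))
  have de3 : δ ≤ e3 := (min_le_right _ _).trans ((min_le_right _ _).trans (min_le_left _ _))
  have dδL : δ ≤ δL := (min_le_right _ _).trans ((min_le_right _ _).trans (min_le_right _ _))
  set A : ℝ := max (max A0 A1) (max A2 A3) with hA_def
  have aA0 : A0 ≤ A := le_max_of_le_left (le_max_left _ _)
  have aA1 : A1 ≤ A := le_max_of_le_left (le_max_right _ _)
  have aA2 : A2 ≤ A := le_max_of_le_right (le_max_left _ _)
  have aA3 : A3 ≤ A := le_max_of_le_right (le_max_right _ _)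
  have hA : 0 ≤ A := hA0.le.trans aA0
  set κ₀ : ℝ := max κ0 κL with hκ₀_def
  have hκ₀ : 0 ≤ κ₀ := hκ0.trans (le_max_left _ _)
  set m₀ : ℝ := max (max m0 D1) (max D2 D3) with hm₀_def
  have bm0 : m0 ≤ m₀ := le_max_of_le_left (le_max_left _ _)
  have bD1 : D1 ≤ m₀ := le_max_of_le_left (le_max_right _ _)
  have bD2 : D2 ≤ m₀ := le_max_of_le_right (le_max_left _ _)
  have bD3 : D3 ≤ m₀ := le_max_of_le_right (le_max_right _ _)
  have hm₀ : 0 ≤ m₀ := hm0.le.trans bm0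
  set r₀ : ℝ := max r0 rL with hr₀_def
  have hr₀ : 0 ≤ r₀ := hr0.le.trans (le_max_left _ _)
  set γ : ℝ := min (1 / (8 * ((d : ℝ) + 1))) γL with hγ_def
  have hγ : 0 < γ := lt_min (by positivity) hγL
  have hγ8 : γ ≤ 1 / (8 * ((d : ℝ) + 1)) := min_le_left _ _
  have hγL' : γ ≤ γL := min_le_right _ _
  have hγ16 : γ ≤ 1 / 16 := by
    refine hγ8.trans (one_div_le_one_div_of_le (by norm_num) ?_)
    have : (1 : ℝ) ≤ (d : ℝ) := by exact_mod_cast hd1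
    linarith
  refine ⟨δ, A, κ₀, m₀, r₀, γ, hδ, hA, hκ₀, hm₀, hr₀, hγ, fun m kk r hk hn4 μ ν hM => ?_⟩
  -- the index's numbers
  have hx : (1 : ℝ) ≤ (L : ℝ) ^ kk := one_le_pow₀ (by exact_mod_cast hL1)
  have hxm : (0 : ℝ) < (L : ℝ) ^ m := pow_pos (by exact_mod_cast (show 0 < L by omega)) _
  have hθ0 : 0 ≤ ((L : ℝ) ^ kk) ^ (-γ) := Real.rpow_nonneg (zero_le_one.trans hx) _
  have hρ16 : ((L ^ kk : ℕ) : ℝ) ^ (-(1 / 16 : ℝ)) ≤ ((L : ℝ) ^ kk) ^ (-γ) := by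
    rw [Nat.cast_pow]; exact Real.rpow_le_rpow_of_exponent_le hx (neg_le_neg hγ16)
  have hρ8 : ((L ^ kk : ℕ) : ℝ) ^ (-(1 / (8 * ((d : ℝ) + 1)))) ≤ ((L : ℝ) ^ kk) ^ (-γ) := by
    rw [Nat.cast_pow]; exact Real.rpow_le_rpow_of_exponent_le hx (neg_le_neg hγ8)
  have hρL : ((L : ℝ) ^ kk) ^ (-γL) ≤ ((L : ℝ) ^ kk) ^ (-γ) := Real.rpow_le_rpow_of_exponent_le hx (neg_le_neg hγL')
  have hρ16_0 : 0 ≤ ((L ^ kk : ℕ) : ℝ) ^ (-(1 / 16 : ℝ)) := Real.rpow_nonneg (Nat.cast_nonneg _) _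
  have hρ8_0 : 0 ≤ ((L ^ kk : ℕ) : ℝ) ^ (-(1 / (8 * ((d : ℝ) + 1)))) := Real.rpow_nonneg (Nat.cast_nonneg _) _
  have hρL_0 : 0 ≤ ((L : ℝ) ^ kk) ^ (-γL) := Real.rpow_nonneg (zero_le_one.trans hx) _
  have hwcast : ((L ^ m : ℕ) : ℝ) = (L : ℝ) ^ m := Nat.cast_pow L m
  have hκw : κ0 / ((L ^ m : ℕ) : ℝ) ≤ κ₀ / (L : ℝ) ^ m := by
    rw [hwcast]; exact div_le_div_of_nonneg_right (le_max_left _ _) hxm.le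
  have hκLw : κL / (L : ℝ) ^ m ≤ κ₀ / (L : ℝ) ^ m := div_le_div_of_nonneg_right (le_max_right _ _) hxm.le
  have hκ₀w : 0 ≤ κ₀ / (L : ℝ) ^ m := div_nonneg hκ₀ hxm.le
  have hmθ : 0 ≤ m₀ * ((L : ℝ) ^ kk) ^ (-γ) := mul_nonneg hm₀ hθ0
  have hrθ : 0 ≤ r₀ * ((L : ℝ) ^ kk) ^ (-γ) := mul_nonneg hr₀ hθ0
  have ht : ∀ y y' : Tor (MP (paramsOf d L (m + 1) kk hL)), 0 ≤ tdistT (MP (paramsOf d L (m + 1) kk hL)) y y' := fun y y' => tdistT_nonneg _ _ _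
  -- the rows at the index
  obtain ⟨g0, gR, gR', gI0, gIR⟩ := H0 m kk r hk hn4
  have g1 := H1 m kk r hk μ
  have g1d := H1d m kk r hk hn4 μ
  have g2 := H2 m kk hk ν
  have g2d := H2d m kk r hk hn4 ν
  have g3 := H3 m kk r hk
  have g3d := H3d m kk r hk hn4
  obtain ⟨gL, gL', gIL⟩ := HL m kk r hk hn4 hM
  -- fine blocks through King's pairing
  have hblk : (fun x : Tor (fine (L ^ r * L ^ kk) (MP (paramsOf d L (m + 1) kk hL))) × Fin (d + 1) =>
      blockOf (L ^ r * L ^ kk) (MP (paramsOf d L (m + 1) kk hL)) x.1) =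
      blkFine L kk (MP (paramsOf d L (m + 1) kk hL)) ∘ kingPrV L kk r (MP (paramsOf d L (m + 1) kk hL)) :=
    (blkFine_comp_kingPrV (M := MP (paramsOf d L (m + 1) kk hL)) L kk r).symm
  rw [hblk] at g0 gR' gI0 gIR g1 g1d g2d g3 g3d gL' gIL
  refine ⟨g0.mono fun y y' => knitMaj_weaken₁ (ht y y') aA0 hA dδ0, g1.mono fun y y' => knitMaj_weaken₁ (ht y y') aA1 hA dδ1,
    g2.mono fun y y' => knitMaj_weaken₁ (ht y y') aA2 hA dδ2, g3.mono fun y y' => knitMaj_weaken₁ (ht y y') aA3 hA dδ3,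
    gR.mono fun y y' => knitMaj_weaken₁ (ht y y') hκw hκ₀w dδ0, gR'.mono fun y y' => knitMaj_weaken₁ (ht y y') hκw hκ₀w dδ0,
    gL.mono fun y y' => knitMaj_weaken₁ (ht y y') hκLw hκ₀w dδL, gL'.mono fun y y' => knitMaj_weaken₁ (ht y y') hκLw hκ₀w dδL,
    gI0.mono fun y y' => knitMaj_weaken (ht y y') bm0 hm₀ hρ16 hρ16_0 dδ0, g1d.mono fun y y' => knitMaj_weaken (ht y y') bD1 hm₀ hρ16 hρ16_0 de1,
    g2d.mono fun y y' => knitMaj_weaken (ht y y') bD2 hm₀ hρ8 hρ8_0 de2, g3d.mono fun y y' => knitMaj_weaken (ht y y') bD3 hm₀ hρ16 hρ16_0 de3,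
    gIR.mono fun y y' => knitMaj_weaken (ht y y') (le_max_left _ _) hr₀ hρ16 hρ16_0 dδ0,
    gIL.mono fun y y' => knitMaj_weaken (ht y y') (le_max_right _ _) hr₀ hρL hρL_0 dδL⟩

end Bundle

end Summit.QuantumFields.YangMills.BalabanUVNodes.N15.Gluing

end
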